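import Summits.CriticalPhenomena.PercolationContinuityZ3.Theorems.PercNearOneGluingAdditiveGluingFingerFourRelays
import HarnessLib

/-! # Crux `PercNearOneGluing.AdditiveGluing` (stmt-CriticalPhenomena-4576) — `stub_fingerML3_vp` when the fingers touch at most TWO relays
# (seat (b) V⁺-form, depth prover `png-dp-vplus`)

Support file (`--supports stmt-CriticalPhenomena-4576`); no definitions, no named facts.

`fingerML3_twoTouched`: the registered stub `stub_fingerML3_vp` for an ARBITRARY relay set `A`, provided the fingers (pairwise non-adjacent) have
positive-weight pairs to at most two relays `w₁, w₂ ≠ b`.  Reduction to `fingerML3_of_card_le_four_noB` on the relay set `A' = {b, d} ∪ (A ∩ {w₁,w₂})`: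
the stub's hypotheses restrict to `A'`, and the events "some pair `N–A` open" and "some pair `N–A'` open" agree almost surely (`real_fingerR_eq_of_subset`).
[cite: KozmaNitzan2024, Lemma 3 (pp. 6–7), §3.2 pp. 12–14, §4 p. 20, Question 9 (p. 36)]
-/

namespace Summit.CriticalPhenomena.PercolationContinuityZ3.Theorems

open MeasureTheory Set
open Literature.Probability.LatticeModels (prodBernoulli)
open Literature.Probability.Percolation (BondConfig openConn openGraph pinW localCylinder)

noncomputable section
open Classical

section FingerTwoTouched

open Literature.Probability.LatticeModels Literature.Probability.Percolation

variable {n : ℕ}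

/-- If the pairs from `N` to the relays of `A ∖ A'` have weight `0` (`A' ⊆ A`), then "some pair `N–A` open" and "some pair `N–A'` open" agree
almost surely: inside any probability the relay set may be shrunk to `A'`. [folklore] -/
theorem real_fingerR_eq_of_subset (g : Sym2 (Fin n) → unitInterval) (A A' N : Finset (Fin n)) (hA' : A' ⊆ A)
    (h0 : ∀ v ∈ N, ∀ a ∈ A, a ∉ A' → g s(v, a) = 0) (E : Set (BondConfig (Fin n))) :
    (prodBernoulli g).real ({ω : Set (Sym2 (Fin n)) | ∃ v ∈ N, ∃ a ∈ A, s(v, a) ∈ ω} ∩ E) =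
      (prodBernoulli g).real ({ω : Set (Sym2 (Fin n)) | ∃ v ∈ N, ∃ a ∈ A', s(v, a) ∈ ω} ∩ E) := by
  have hae : ∀ᵐ ω ∂(prodBernoulli g), ∀ v ∈ N, ∀ a ∈ A \ A', s(v, a) ∉ ω := by
    refine (Filter.eventually_all_finset N).2 fun v hv => (Filter.eventually_all_finset (A \ A')).2 fun a ha => ?_
    obtain ⟨haA, haA'⟩ := Finset.mem_sdiff.1 ha
    exact prodBernoulli_ae_notMem g (h0 v hv a haA haA')
  refine measureReal_congr ?_
  filter_upwards [hae] with ω hω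
  refine propext ⟨?_, ?_⟩
  · rintro ⟨⟨v, hv, a, ha, hva⟩, hE⟩
    refine ⟨⟨v, hv, a, ?_, hva⟩, hE⟩
    by_contra haA'
    exact hω v hv a (Finset.mem_sdiff.2 ⟨ha, haA'⟩) hva
  · rintro ⟨⟨v, hv, a, ha, hva⟩, hE⟩
    exact ⟨⟨v, hv, a, hA' ha, hva⟩, hE⟩

/-- **`stub_fingerML3_vp` when the fingers touch at most two relays (any `A`).**  Stub setting (`b, d ∈ A`, finger block `N` disjoint from `A`,
fingers free off `A`, `μ_K(d↔b) ≤ μ_K(a↔b)` on `A`); the fingers are pairwise non-adjacent and every pair from `N` to a relay other than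
`w₁, w₂` (two vertices `≠ b`) has weight `0`.  Then `μ_{K/N}(R ∩ {d↔b}) ≤ μ_{K/N}(R ∩ ⋃_{v∈N}{v↔b})`.
[cite: KozmaNitzan2024, Lemma 3 (pp. 6–7), §3.2 pp. 12–14, §4 p. 20, Question 9 (p. 36)] -/
theorem fingerML3_twoTouched (K : Sym2 (Fin n) → unitInterval) (A N : Finset (Fin n)) (d b w₁ w₂ : Fin n)
    (hb : b ∈ A) (hNA : Disjoint N A) (hd : d ∈ A) (hw₁b : w₁ ≠ b) (hw₂b : w₂ ≠ b)
    (hfree : ∀ v ∈ N, ∀ y : Fin n, y ∉ A → y ∉ N → (K s(v, y) : ℝ) = 0)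
    (hle : ∀ a ∈ A, (prodBernoulli K).real (openConn d b) ≤ (prodBernoulli K).real (openConn a b))
    (htwo : ∀ v ∈ N, ∀ a ∈ A, a ≠ w₁ → a ≠ w₂ → (K s(v, a) : ℝ) = 0)
    (hint : ∀ v ∈ N, ∀ v' ∈ N, v ≠ v' → (K s(v, v') : ℝ) = 0) :
    (prodBernoulli (fun e' : Sym2 (Fin n) => if (∀ y ∈ e', y ∈ N) ∧ ¬ e'.IsDiag then 1 else K e')).real
        ({ω : Set (Sym2 (Fin n)) | ∃ v ∈ N, ∃ a ∈ A, s(v, a) ∈ ω} ∩ openConn d b) ≤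
      (prodBernoulli (fun e' : Sym2 (Fin n) => if (∀ y ∈ e', y ∈ N) ∧ ¬ e'.IsDiag then 1 else K e')).real
        ({ω : Set (Sym2 (Fin n)) | ∃ v ∈ N, ∃ a ∈ A, s(v, a) ∈ ω} ∩ ⋃ v ∈ N, openConn v b) := by
  set g : Sym2 (Fin n) → unitInterval := fun e' => if (∀ y ∈ e', y ∈ N) ∧ ¬ e'.IsDiag then 1 else K e' with hg
  -- the reduced relay set
  set A' : Finset (Fin n) := insert b (insert d (A.filter fun a => a = w₁ ∨ a = w₂)) with hA'def
  have hA'sub : A' ⊆ A := by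
    intro a ha
    rcases Finset.mem_insert.1 ha with rfl | ha
    · exact hb
    rcases Finset.mem_insert.1 ha with rfl | ha
    · exact hd
    exact (Finset.mem_filter.1 ha).1
  have hb' : b ∈ A' := Finset.mem_insert_self _ _
  have hd' : d ∈ A' := Finset.mem_insert_of_mem (Finset.mem_insert_self _ _)
  have hNA' : Disjoint N A' := hNA.mono_right hA'sub
  have hcard : A'.card ≤ 4 := by
    have h1 : (A.filter fun a => a = w₁ ∨ a = w₂).card ≤ 2 := by
      calc (A.filter fun a => a = w₁ ∨ a = w₂).card ≤ ({w₁, w₂} : Finset (Fin n)).card :=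
            Finset.card_le_card fun a ha => by
              rcases (Finset.mem_filter.1 ha).2 with rfl | rfl <;> simp
        _ ≤ 2 := Finset.card_le_two
    have h2 := Finset.card_insert_le d (A.filter fun a => a = w₁ ∨ a = w₂)
    have h3 := Finset.card_insert_le b (insert d (A.filter fun a => a = w₁ ∨ a = w₂))
    have h4 : A'.card = (insert b (insert d (A.filter fun a => a = w₁ ∨ a = w₂))).card := rfl
    omega
  -- which relays are outside `A'`
  have hout : ∀ a ∈ A, a ∉ A' → a ≠ w₁ ∧ a ≠ w₂ := by
    intro a ha haA'
    constructor
    · rintro rfl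
      exact haA' (Finset.mem_insert_of_mem (Finset.mem_insert_of_mem (Finset.mem_filter.2 ⟨ha, Or.inl rfl⟩)))
    · rintro rfl
      exact haA' (Finset.mem_insert_of_mem (Finset.mem_insert_of_mem (Finset.mem_filter.2 ⟨ha, Or.inr rfl⟩)))
  have hfree' : ∀ v ∈ N, ∀ y : Fin n, y ∉ A' → y ∉ N → (K s(v, y) : ℝ) = 0 := by
    intro v hv y hyA' hyN
    by_cases hyA : y ∈ A
    · obtain ⟨h1, h2⟩ := hout y hyA hyA'
      exact htwo v hv y hyA h1 h2
    · exact hfree v hv y hyA hyN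
  have hle' : ∀ a ∈ A', (prodBernoulli K).real (openConn d b) ≤ (prodBernoulli K).real (openConn a b) :=
    fun a ha => hle a (hA'sub ha)
  have hnoB : ∀ v ∈ N, (K s(v, b) : ℝ) = 0 := fun v hv => htwo v hv b hb hw₁b.symm hw₂b.symm
  have h4 := fingerML3_of_card_le_four_noB K A' N d b hb' hNA' hd' hcard hfree' hle' hnoB hint
  -- shrink `A` to `A'` in both probabilities
  have hg0 : ∀ v ∈ N, ∀ a ∈ A, a ∉ A' → g s(v, a) = 0 := by
    intro v hv a ha haA'
    have haN : a ∉ N := Finset.disjoint_left.1 hNA.symm ha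
    have hnot : ¬ ((∀ y ∈ s(v, a), y ∈ N) ∧ ¬ (s(v, a)).IsDiag) := fun h => haN (h.1 a (Sym2.mem_mk_right v a))
    simp only [hg, hnot, if_false]
    obtain ⟨h1, h2⟩ := hout a ha haA'
    exact Set.Icc.coe_eq_zero.1 (htwo v hv a ha h1 h2)
  rw [real_fingerR_eq_of_subset g A A' N hA'sub hg0, real_fingerR_eq_of_subset g A A' N hA'sub hg0]
  exact h4

end FingerTwoTouched

end

end Summit.CriticalPhenomena.PercolationContinuityZ3.Theorems
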